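import Literature.NumberTheory.Rogawski1990.LocalTransfer
import Literature.NumberTheory.GaloisCohomology.NonAbelianH1
import Mathlib.RepresentationTheory.Homological.GroupCohomology.LowDegree
import Mathlib.GroupTheory.GroupAction.ConjAct
import Mathlib.LinearAlgebra.Matrix.Notation
import HarnessLib

/-!
# Langlands–Shelstad (1987), §5 «Regular Unipotent Analysis» — the numbered statements as named predicates

R. P. Langlands, D. Shelstad, *On the definition of transfer factors*, Math. Ann. **278** (1987) 219–271
[LanglandsShelstad1987], §5 = Math. Ann. pp. 254–264 (page pins «(p. N)» below are the PRINTED Math. Ann. pages, read in the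
GDZ scan texts `lit/lit3/g0/texts/LanglandsShelstad1987-GDZ/p0254…p0264`; the statements were transcribed from the authors'
reissue `paper:doi-10-1007-bf01458070`, own pagination pp. 41–51, numbering identical).  Contents of §5: (5.1) Regular unipotent
elements (review) — Lemma 5.1.A and the unipotent transfer factor `Δ(u)`; (5.2) Stars and the variety `X` (review of [L3]) with
(5.2.1); (5.3) Regular unipotent elements and `X` — Lemma 5.3.A, Lemma 5.3.B, Corollary 5.3.C; (5.4) Orbital integrals as fibre
integrals — the fibre formula, Lemma 5.4.A, Lemma 5.4.B; (5.5) A limit formula — Theorem 5.5.A, Corollary 5.5.B.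
Squad TN (HCML «GO 500», SPLIT-v1 row TN-t07); topic `NumberTheory/Automorphic/LanglandsShelstad1987`, namespace
`Literature.NumberTheory.Automorphic.LanglandsShelstad1987.RegularUnipotent`.  STATEMENTS ONLY: no theorem, no `sorry`, no
axiom, no instance, no notation.

## Standing setting of §5 (p. 254–255)
`G` connected reductive and QUASI-SPLIT over `F` («From now on `G` will be quasi-split over `F`», p. 255), `(B, T, {X_α})` an
`F`-splitting, `B_∞ = T N_∞` the opposite Borel subgroup, `Ω` the Weyl group, `𝒲` the Weyl chambers with `W₊` the chamber of
`B`, `W(ω) = ω⁻¹ W₊`; from (5.4) on `F` is local, an endoscopic datum `(H, ℋ, s, ξ)` and an admissible embedding `T_H → T` are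
fixed, and `Δ(γ_H, γ_G)` is the transfer factor of (3.7) built, «for reasons that will appear later», with the OPPOSITE splitting
`spl_∞ = (B_∞, T, {X_{−α}})` (p. 256).

## How §5 is typed here, and why as PREDICATES
Reductive groups over local fields, Borel subgroups, splittings, the star variety of [L3], Galois cohomology of tori and the
transfer factor of (3.7) are not objects of Mathlib or of the tree.  As in the sibling carpets of this directory
(`Properties.lean`, TN-t03; the squad ruling «predicates on explicit PARAMETERS», COORDINATION NOTE 1 (b)) every numbered item is a
`def … : Prop` whose binders ARE the data of the statement, in print's words:
* `G` — the abstract group `G(F̄)` with the Galois group `Γ` acting by automorphisms (`[MulDistribMulAction Γ G]`; `G(F)` = the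
  `Γ`-fixed elements); Borel subgroups are `Subgroup G`'s singled out by a predicate `IsBorel`, conjugation is Mathlib's pointwise
  action of `ConjAct G` on `Subgroup G`; `B = G(F)`-level statements ((5.1), (5.5)) use a bare group `B` («`G(F)`») and Mathlib's
  `IsConj` for `G(F)`-conjugacy;
* `Ω` — the Weyl group, `𝒲` — the set of Weyl chambers with its `Ω`-action and the transported Galois action `σ_T`
  (`[MulAction Ω 𝒲] [MulAction Γ 𝒲]`), `Wplus : 𝒲` — `W₊`; a STAR is a function `𝒲 → Subgroup G` (p. 257: «the elements of `𝔖`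
  are functions from `𝒲` to `𝔅`, the variety of Borel subgroups of `G`»);
* the STAR VARIETY's algebraic geometry (Zariski closure, smoothness, local invertibility) enters only through a topology on
  `G × Star` given as a binder — `X` is DEFINED as the closure of `X⁰` for it (p. 257) — and the two purely scheme-theoretic
  items (Lemma 5.3.A (iii), Corollary 5.3.C) are recorded in the census below as not typed;
* orbital integrals, transfer factors as data and «`Δ`-matching orbital integrals» are the tree's CURRENCY ★
  `Literature.NumberTheory.Rogawski1990.TransferFactorData` (`Δ : A → B → ℂ` supported on the matching relation, a class function),
  ★ `Literature.NumberTheory.Automorphic.classOrbitalIntegral` ∕ `OrbitalMeasureFamily` (the orbital integral `Φ([γ], f)` against a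
  per-class measure family — print's `|ω_γ^*|`, `|ω_z|` of (1.4), (5.4), (5.5) are such families) and ★
  `Literature.NumberTheory.Rogawski1990.IsDeltaTransferRel` («`f`, `f^H` have `Δ`-matching orbital integrals»: `Φ^st(γ_H, f^H) =
  Σ_{[γ]} Δ(γ_H, γ) Φ([γ], f)`) — cited, not restated; `A` is the group `H(F)` (from (5.5) on: `H₁(F)`), `B` is `G(F)`;
* the torus cohomology of Lemma 5.4.A follows the squad carriers of `Defs.lean` (TN-t01, (C1)–(C5)): `X = X_*(T_sc)` with the
  `σ_T`-action of `Γ` (`[DistribMulAction Γ X]`), coroots `R ⊂ X` (print's roots `α` are indexed by `α^∨ ∈ R`, as in (2.3) p. 232: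
  «`R = R^∨(G, T)`»), a gauge `p : X → ℤˣ` («`p(α) = 1` iff `α` is a root of `T` in `B_T`», p. 259), a-data `a : X → K̄ˣ`; the
  coefficient group `T_sc(F̄) = X_*(T_sc) ⊗ F̄^×` with its (diagonal) Galois action is an abstract `Γ`-module `M` with the map
  `cpow c λ = c^λ` (`= Defs.unitPow c λ`, additively), so that «is represented by the cocycle» is Mathlib's
  `groupCohomology.IsCoboundary₁` of the difference (squad ruling (R1): instance binders, the consumer instantiates with `(inst := …)`).
For every predicate: instantiated with print's objects it is exactly the printed statement; `∀ data, …` is NOT claimed and is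
false for junk data («consumers instantiate with their data»).  Where print DEFINES an object the definition is REAL (a `def` with a
body): `invCocycle` (an `abbrev` for ★ `GaloisCohomology.splitCocycle`), `unipotentFactor`, `chamberOf`, `starConj`, `starGal`, `standardStar`, `IsRegularStar`, `frakA`, `starsOpp`,
`starsOppB`, `InStar`, `X0`, `XVar`, `springerGrothendieck`, `xiMap`, `piMap`, `starOfBorel`, `pointOf`, `unipotentSide`.

## Item ↦ declaration (paper order; Math. Ann. page ∕ reissue page)
| print | p. (reissue) | declaration |
|---|---|---|
| (5.1) `inv(u)` = class of `σ ↦ h σ(h)⁻¹` | 256 (42) | `invCocycle` (= ★ `GaloisCohomology.splitCocycle`), `invCocycle_apply`, `isNonAbelianCocycle₁_invCocycle` |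
| Lemma 5.1.A (`u ↦ spl(u)` bijection on `G(F)`-classes) | 255 (42) | `Lemma51ASplBijection` |
| (5.1) `Δ(u) = Δ(γ̄_H, γ̄_G)/Δ₀(γ̄_H, γ̄_G) · ⟨inv(u), s⟩` | 256 (42) | `unipotentFactor` |
| (5.1) «`Δ(u)` depends only on the `G(F)`-conjugacy class of `u`» | 256 (42) | `Par51FactorClassFunction` |
| (5.2) `W(ω) = ω⁻¹W₊`, star actions, `s₀`, regular stars, `𝔄(T)`, `𝔖(B_∞)`, `𝔖(B_∞, B)` | 256–257 (43) | `chamberOf`, `starConj`, `starGal`, `standardStar`, `IsRegularStar`, `frakA`, `starsOpp`, `starsOppB` |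
| (5.2) «the `F`-rational regular stars form the orbit of `s₀` under `𝔄(T)`» | 257 (43) | `Par52RationalRegularStars` |
| (5.2) «`(n, (B(W))) ↦ (B(W))^n` … allows us to identify `N_∞ × 𝔖(B_∞, B)` and `𝔖(B_∞)`» | 257 (43) | `Par52Chart` |
| (5.2.1) `σ(z(ω, α)) = z(σωσ_T⁻¹, σα)` | 257 (43) | `Eq521GaloisOnCoordinates` |
| (5.2) `g ∈ s`, `X⁰`, `X`, `𝔐`, `ξ`, `π` | 257 (44) | `InStar`, `X0`, `XVar`, `springerGrothendieck`, `xiMap`, `piMap` |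
| (5.2) «`X` is contained in `{(g, s) : g ∈ s}`» | 257 (44) | `Par52ClosureInStars` |
| (5.2) «`ξ : X⁰ → 𝔐⁰` is an isomorphism» (bijection of points) | 257 (44) | `Par52XiBijOnRegular` |
| (5.2) «`φ⁻¹(γ)` is the `G`-orbit of `(γ, s₀)`», «`φ⁻¹(γ)(F)` is identified with the stable conjugacy class of `γ` in `G(F)`» | 257 (44) | `Par52FibreRegular`, `Par52FibreRational` |
| (5.3) `s_u`, `x_u = (u, s_u)` | 257 (44) | `starOfBorel`, `pointOf` |
| Lemma 5.3.A (i), (ii) | 257 (44) | `Lemma53Ai`, `Lemma53Aii` |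
| Lemma 5.3.A (iii) «`ξ : X → 𝔐` is invertible at `x_u`» | 257 (44) | not typed — local invertibility of a morphism of `F`-varieties (see below) |
| (5.3) the `SL(2)` computation `xz = 1 − α(t)⁻¹`, `a₁ = a⁻¹`, `x₁ = a²x` | 258 (44–45) | `Par53SL2Computation` (proved: `Par53SL2Computation_holds`) |
| Lemma 5.3.B | 258 (45) | `Lemma53BCoordinates` |
| Corollary 5.3.C «`φ : X → T` is smooth at `x_u`» | 259 (45) | not typed — smoothness of a morphism of `F`-varieties at a point |
| (5.4) the fibre-integral formula `D_H(γ_H) Σ Δ(γ_H,γ_G)Φ(γ_G,f) = ∫_{φ⁻¹(γ)(F)} Δ(x) f(π(x)) |ω_γ^*|` | 259–260 (46) | `Par54FibreIntegral` |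
| Lemma 5.4.A | 260 (47) | `Lemma54ACocycle` |
| Lemma 5.4.B | 261 (48) | `Lemma54BCoordinateLimit` |
| Theorem 5.5.A (limit formula) + `λ_G(z₁) Σ_u Δ(u) Φ(zu, f)` | 262 (49) | `Thm55ALimitFormula`, `unipotentSide` |
| Corollary 5.5.B | 262 (49) | `Cor55BUnipotentMatching` |

NOT typed here (census): the review paragraphs of (5.1) quoted from [St], [K1] (characterisation of regular unipotents by a unique
Borel subgroup, `u = t⁻¹u′u₀t`, the equivalence (i) quasi-split ⇔ (ii) `F`-splitting ⇔ (iii) regular unipotent `F`-points) —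
not LS results; «`inv(u), s` is independent of the choice for `T`» and «`Δ(u)` is independent of the choice of spl» (p. 256) — they
concern the construction of `⟨·, s_T⟩` of (3.1)–(3.2) (file `TransferFactorDefinition`, TN-t02) and are covered operationally by
`Par51FactorClassFunction`; Lemma 5.3.A (iii) and Corollary 5.3.C — scheme-theoretic local invertibility ∕ smoothness at a point
of morphisms between the `F`-varieties `X`, `𝔐`, `T`, for which neither Mathlib (whose `AlgebraicGeometry` smoothness is for
scheme morphisms we cannot build here) nor the tree has a carrier — no shadow predicate is introduced; the measure identities
`|ω_γ| = ∏_α |1 − α(γ)⁻¹| |ω_G|/|ω_T|` ([L3, Lemma 2.12]) and `|ω_γ^*| = D_G(γ)|ω_G|/|ω_T|` (p. 259) — invariant differential forms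
on varieties; the proofs (pp. 255, 258, 260–264); §6 (file `GlobalProductFormula`, TN-t03).

DEDUP.  `lean search --decl` for `regularUnipotent|Splitting|Springer|germ|limitFormula` finds in the tree only the explicit
`U(3)` regular unipotent normal form (`Automorphic/UnitaryThreeRegularUnipotentClass`) and the finite-field census
(`GroupTheory/SpecificGroups/FiniteUnitaryThreeUnipotentCensus`) — models, not the abstract statements, which are new; 0 tree files
carry a `[cite: LanglandsShelstad1987, §5 …]` tag (planner's DEDUP list).  The transfer relations are the tree's (cited above).

## References
* [LanglandsShelstad1987] R. P. Langlands, D. Shelstad, *On the definition of transfer factors*, Math. Ann. 278 (1987) 219–271,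
  §5 pp. 254–264 (GDZ scan texts p0254–p0264 read for the page pins; reissue `paper:doi-10-1007-bf01458070` pp. 41–51 read for the
  statements), with (1.4) pp. 226–227, (2.3) pp. 231–235, (3.1)–(3.4) pp. 242–248, (3.7) p. 251, (4.4) pp. 252–254.
* [L3] R. P. Langlands, *Orbital integrals on forms of SL(3). I*, Amer. J. Math. 105 (1983) — the star variety, Lemma 2.8,
  Lemma 2.12, Proposition 5.2 (cited by print in (5.2), (5.4); not used here beyond the names).
* [St] R. Steinberg, *Conjugacy classes in algebraic groups*, LNM 366 — pp. 110–112 (cited by print in (5.1)).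
* [Rogawski1990] J. D. Rogawski, *Automorphic Representations of Unitary Groups in Three Variables* (1990), §4.3 (4.3.1) — the
  tree's `TransferFactorData` ∕ `IsDeltaTransferRel` currency used for (5.4)–(5.5).
-/

open Filter Topology MeasureTheory
open scoped Pointwise

namespace Literature.NumberTheory.Automorphic.LanglandsShelstad1987.RegularUnipotent

open Literature.NumberTheory.Automorphic (OrbitalMeasureFamily classOrbitalIntegral)
open Literature.NumberTheory.Rogawski1990 (TransferFactorData IsDeltaTransferRel)

/-! ## (5.1) Regular unipotent elements: Lemma 5.1.A and the factor `Δ(u)` (pp. 254–256) -/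

section FiveOne

variable {Γ : Type*} [Group Γ] {Gsc : Type*} [Group Gsc] [MulDistribMulAction Γ Gsc]

/-- **[LanglandsShelstad1987, (5.1) (p. 256)]**, the invariant `inv(u)`: «Fix an `F`-splitting spl `= (B, T, {X_α})` of `G`.
There exists `h ∈ G_sc` such that `spl(u)^h =` spl … Then `hσ(h)⁻¹` lies in the center `Z_sc` of `G_sc`, `σ ∈ Γ`.  The class
`inv(u)` of `σ → hσ(h)⁻¹` in `H¹(Γ, Z_sc)` is well-defined.»  REAL definition of the cochain `σ ↦ h σ(h)⁻¹` for `h ∈ G_sc(F̄)`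
(`Γ` acting on `G_sc(F̄)` by `σ • ·`); its centrality and the independence of the class from `h` are print's assertions, not
recorded.  This is the tree՚s ★ `Literature.NumberTheory.GaloisCohomology.splitCocycle` («split cocycle of `h`»,
[Berhuy2010, §II.3 Lemma II.3.9]) kept under print՚s name; see `invCocycle_apply`, `isNonAbelianCocycle₁_invCocycle`.
[cite: LanglandsShelstad1987, §5.1 (p. 256)] -/
abbrev invCocycle (h : Gsc) : Γ → Gsc := GaloisCohomology.splitCocycle h

/-- Unfolding `invCocycle`: `inv(u)(σ) = h σ(h)⁻¹`. [cite: LanglandsShelstad1987, §5.1 (p. 256)] -/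
theorem invCocycle_apply (h : Gsc) (σ : Γ) : invCocycle h σ = h * (σ • h)⁻¹ := rfl

/-- `σ ↦ h σ(h)⁻¹` is a `1`-cocycle (★ `isNonAbelianCocycle₁_splitCocycle`). [cite: LanglandsShelstad1987, §5.1 (p. 256)] -/
theorem isNonAbelianCocycle₁_invCocycle (h : Gsc) : GaloisCohomology.IsNonAbelianCocycle₁ (invCocycle (Γ := Γ) h) :=
  GaloisCohomology.isNonAbelianCocycle₁_splitCocycle h

variable {B : Type*} [Group B] {Spl : Type*} [MulAction B Spl]

/-- **[LanglandsShelstad1987, Lemma 5.1.A (p. 255)]**: «The correspondence `u → spl(u)` induces a bijection between the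
`G(F)`-conjugacy classes of regular unipotent elements in `G(F)` and the `G(F)`-conjugacy classes of `F`-splittings of `G`.»
Data: `B` = `G(F)`; `U ⊆ B` the regular unipotent elements of `G(F)`; `Spl` the set of `F`-splittings of `G` with its
`G(F)`-action (`g • spl` = print's `spl^{g⁻¹}`; orbits are the same); `spl : B → Spl` a choice of `spl(u) = (B_u, T_u, {X_α^u})`
with `T_u` over `F` for `u ∈ U` (p. 255: determined by `u` up to `N(F)`-conjugacy — so only its class is canonical; values off `U`
are never read).  Typed as the three clauses of «induces a bijection on classes»: for `u₁, u₂ ∈ U`,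
`IsConj u₁ u₂ ↔ (spl u₁, spl u₂ lie in one G(F)-orbit)` (well-defined and injective), and every orbit of `Spl` meets `spl(U)`
(surjective). [cite: LanglandsShelstad1987, Lemma 5.1.A (p. 255)] -/
def Lemma51ASplBijection (U : Set B) (spl : B → Spl) : Prop :=
  (∀ ⦃u₁ u₂ : B⦄, u₁ ∈ U → u₂ ∈ U → (IsConj u₁ u₂ ↔ ∃ g : B, g • spl u₁ = spl u₂)) ∧
    ∀ s : Spl, ∃ u ∈ U, ∃ g : B, g • spl u = s

/-- **[LanglandsShelstad1987, (5.1) (p. 256)]**, the unipotent transfer factor: «if we define `Δ(γ̄_H, γ̄_G)` and `Δ₀(γ̄_H, γ̄_G)` as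
in (3.7), but use … the opposite splitting `spl_∞ = (B_∞, T, {X_{−α}})` … then
`Δ(u) = (Δ(γ̄_H, γ̄_G) / Δ₀(γ̄_H, γ̄_G)) · ⟨inv(u), s⟩` is independent of the choice of spl.»  REAL definition from the two
numbers `Δ(γ̄_H, γ̄_G)`, `Δ₀(γ̄_H, γ̄_G)` (the arbitrary normalisation of (3.7) and the canonical `Δ₀` at the fixed pair) and the
Tate–Nakayama value `pair u = ⟨inv(u), s⟩ = ⟨inv_T(u), s_T⟩` ((3.1); a function of `u` here). [cite: LanglandsShelstad1987, §5.1 (p. 256)] -/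
noncomputable def unipotentFactor (Δbar Δ₀bar : ℂ) (pair : B → ℂ) (u : B) : ℂ :=
  Δbar / Δ₀bar * pair u

/-- **[LanglandsShelstad1987, (5.1) (p. 256)]**, last sentence: «Finally, `Δ(u)` depends only on the `G(F)`-conjugacy class of `u`
in `G(F)`.»  Data: `U ⊆ B = G(F)` the regular unipotent elements, `Δu : B → ℂ` the factor `Δ(u)` (e.g. `unipotentFactor …`).
Typed: `u₁, u₂ ∈ U`, `IsConj u₁ u₂ → Δu u₁ = Δu u₂`. [cite: LanglandsShelstad1987, §5.1 (p. 256)] -/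
def Par51FactorClassFunction (U : Set B) (Δu : B → ℂ) : Prop :=
  ∀ ⦃u₁ u₂ : B⦄, u₁ ∈ U → u₂ ∈ U → IsConj u₁ u₂ → Δu u₁ = Δu u₂

end FiveOne

/-! ## (5.2) Stars and the variety `X` (pp. 256–257) -/

section FiveTwo

variable {G : Type*} [Group G] {Γ : Type*} [Group Γ] [MulDistribMulAction Γ G]
variable {Ω : Type*} [Group Ω] {𝒲 : Type*} [MulAction Ω 𝒲] [MulAction Γ 𝒲]

variable (G) in
/-- A STAR (p. 257, [L3]): «the elements of `𝔖` are functions from `𝒲` to `𝔅`, the variety of Borel subgroups of `G`.  A typical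
element will be denoted `(B(W))`.»  Borel subgroups are `Subgroup G`'s of `G = G(F̄)` (those satisfying the consumer's `IsBorel`).
[cite: LanglandsShelstad1987, §5.2 (p. 257)] -/
abbrev Star (𝒲 : Type*) : Type _ := 𝒲 → Subgroup G

/-- `W(ω) = ω⁻¹ W₊` (p. 256: «If `ω ∈ Ω` we write `W(ω)` for the chamber `ω⁻¹W₊`»). [cite: LanglandsShelstad1987, §5.2 (p. 256)] -/
def chamberOf (Wplus : 𝒲) (ω : Ω) : 𝒲 := ω⁻¹ • Wplus

/-- The right action of `G` on stars (p. 257): «`(B(W))^g = (g⁻¹ B(W) g)`» — conjugation of each Borel subgroup by `g⁻¹`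
(Mathlib's pointwise action of `ConjAct G` on `Subgroup G`). [cite: LanglandsShelstad1987, §5.2 (p. 257)] -/
def starConj (s : Star G 𝒲) (g : G) : Star G 𝒲 := fun W => ConjAct.toConjAct g⁻¹ • s W

/-- The `F`-structure on stars (p. 257): «`σ((B(W))) = (σ(B(σ_T⁻¹(W))))`, `σ ∈ Γ`» — `Γ` acting on `G(F̄)` (hence pointwise on
its subgroups) and, through `σ_T`, on the chambers. [cite: LanglandsShelstad1987, §5.2 (p. 257)] -/
def starGal (σ : Γ) (s : Star G 𝒲) : Star G 𝒲 := fun W => σ • s (σ⁻¹ • W)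

/-- The STANDARD star (p. 257): «`s₀` is given by `B(W(ω)) = B_T^ω`, `ω ∈ Ω`», `B_T^ω = w⁻¹ B_T w` with `w ∈ G` representing `ω`
(p. 256).  Data: `BT` the Borel subgroup `B_T ⊃ T`, `n : Ω → G` representatives, `wOf : 𝒲 → Ω` the inverse of `ω ↦ W(ω)` (`Ω`
acts simply transitively on the chambers). [cite: LanglandsShelstad1987, §5.2 (p. 257)] -/
def standardStar (BT : Subgroup G) (n : Ω → G) (wOf : 𝒲 → Ω) : Star G 𝒲 :=
  fun W => ConjAct.toConjAct (n (wOf W))⁻¹ • BT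

/-- «A star is regular if it lies in the `G`-orbit of `s₀`» (p. 257). [cite: LanglandsShelstad1987, §5.2 (p. 257)] -/
def IsRegularStar (s₀ s : Star G 𝒲) : Prop := ∃ g : G, s = starConj s₀ g

/-- `𝔄(T) = {g ∈ G(F̄) : g σ(g⁻¹) ∈ T, σ ∈ Γ}` (p. 257; the set of (1.3)), for the torus `T(F̄) ≤ G(F̄)` given as a subgroup.
[cite: LanglandsShelstad1987, §5.2 (p. 257)] -/
def frakA (T : Subgroup G) : Set G := {g : G | ∀ σ : Γ, g * σ • g⁻¹ ∈ T}

/-- **[LanglandsShelstad1987, (5.2) (p. 257)]**: «The `F`-rational regular stars form the orbit of `s₀` under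
`𝔄(T) = {g ∈ G(F̄) : gσ(g⁻¹) ∈ T}`.»  Typed: a star `s` is regular and `Γ`-fixed for `starGal` iff `s = s₀^g` for some `g ∈ 𝔄(T)`.
Data: `s₀` the standard star, `T(F̄) ≤ G(F̄)`. [cite: LanglandsShelstad1987, §5.2 (p. 257)] -/
def Par52RationalRegularStars (s₀ : Star G 𝒲) (T : Subgroup G) : Prop :=
  ∀ s : Star G 𝒲, (IsRegularStar s₀ s ∧ ∀ σ : Γ, starGal σ s = s) ↔ ∃ g ∈ frakA (Γ := Γ) T, s = starConj s₀ g

/-- `𝔖(B_∞)` (p. 257): «consists of all `(B(W))` for which each `B(W)` is opposite to `B_∞`» — `IsOpp` the relation «opposite Borel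
subgroups» (a parameter). [cite: LanglandsShelstad1987, §5.2 (p. 257)] -/
def starsOpp (IsOpp : Subgroup G → Subgroup G → Prop) (Binf : Subgroup G) : Set (Star G 𝒲) :=
  {s | ∀ W : 𝒲, IsOpp (s W) Binf}

/-- `𝔖(B_∞, B)` (p. 257): «those stars [of `𝔖(B_∞)`] for which we also have `B(W₊) = B`». [cite: LanglandsShelstad1987, §5.2 (p. 257)] -/
def starsOppB (IsOpp : Subgroup G → Subgroup G → Prop) (Binf Bplus : Subgroup G) (Wplus : 𝒲) : Set (Star G 𝒲) :=
  {s | s ∈ starsOpp IsOpp Binf ∧ s Wplus = Bplus}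

omit [MulDistribMulAction Γ G] [MulAction Γ 𝒲] in
/-- **[LanglandsShelstad1987, (5.2) (p. 257)]**: «If `B_∞ = T N_∞` then the morphism `(n, (B(W))) → (B(W))^n` from
`N_∞ × 𝔖(B_∞, B)` to `𝔖(B_∞)` allows us to identify these two varieties» — typed on points: the map is a bijection from
`N_∞ × 𝔖(B_∞, B)` onto `𝔖(B_∞)` (`Ninf ≤ G(F̄)` the unipotent radical of `B_∞`). [cite: LanglandsShelstad1987, §5.2 (p. 257)] -/
def Par52Chart (IsOpp : Subgroup G → Subgroup G → Prop) (Binf Bplus Ninf : Subgroup G) (Wplus : 𝒲) : Prop :=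
  Set.BijOn (fun x : G × Star G 𝒲 => starConj x.2 x.1) ((Ninf : Set G) ×ˢ starsOppB IsOpp Binf Bplus Wplus)
    (starsOpp IsOpp Binf)

/-- **[LanglandsShelstad1987, (5.2.1) (p. 257)]**: for the coordinate functions `z(W, β) = z(ω, α)` on `𝔖(B_∞, B)` (`W = W(ω)`,
`ωβ = α`, p. 257: the unique `h ∈ N_∞` with `hB(W)h⁻¹ = B` gives `hB(W′)h⁻¹ = exp(−zX_{−α}) B exp zX_{−α}`), «We have, for
`F`-rational `(B(W))`, `σ(z(ω, α)) = z(σωσ_T⁻¹, σα)`, `σ ∈ Γ`.»  Data: the coordinates `z : Ω → R → K` of ONE `F`-rational star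
(`K = F̄` with its `Γ`-action, `R` the roots with the Galois action, `Γ` acting on `Ω` by `ω ↦ σωσ_T⁻¹`).
Typed: `σ • z ω α = z (σ • ω) (σ • α)`. [cite: LanglandsShelstad1987, (5.2.1) (p. 257)] -/
def Eq521GaloisOnCoordinates {R K : Type*} [MulAction Γ Ω] [MulAction Γ R] [SMul Γ K] (z : Ω → R → K) : Prop :=
  ∀ (σ : Γ) (ω : Ω) (α : R), σ • z ω α = z (σ • ω) (σ • α)

omit [MulDistribMulAction Γ G] in
/-- «If `g ∈ G` and `s = (B(W))` is a star we write `g ∈ s` if `g ∈ ∩_W B(W)`» (p. 257). [cite: LanglandsShelstad1987, §5.2 (p. 257)] -/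
def InStar (g : G) (s : Star G 𝒲) : Prop := ∀ W : 𝒲, g ∈ s W

/-- `X⁰` (p. 257): «all pairs `(g, s)`, where `g` is regular semisimple, `s` is regular and `g ∈ s`» — `IsRegSS` the regular
semisimple elements of `G(F̄)`, `s₀` the standard star. [cite: LanglandsShelstad1987, §5.2 (p. 257)] -/
def X0 (IsRegSS : G → Prop) (s₀ : Star G 𝒲) : Set (G × Star G 𝒲) :=
  {x | IsRegSS x.1 ∧ IsRegularStar s₀ x.2 ∧ InStar x.1 x.2}

/-- `X` (p. 257): «let `X` be the closure of `X⁰` in `G × 𝔖`» — for the (Zariski) topology on the points of `G × 𝔖`, supplied by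
the consumer as the instance binder. [cite: LanglandsShelstad1987, §5.2 (p. 257)] -/
def XVar [TopologicalSpace (G × Star G 𝒲)] (IsRegSS : G → Prop) (s₀ : Star G 𝒲) : Set (G × Star G 𝒲) :=
  closure (X0 IsRegSS s₀)

variable (G) in
/-- The Springer–Grothendieck variety `𝔐 = {(g, B) : g ∈ B}` (p. 257), on points, `B` ranging over the Borel subgroups
(`IsBorel`). [cite: LanglandsShelstad1987, §5.2 (p. 257)] -/
def springerGrothendieck (IsBorel : Subgroup G → Prop) : Set (G × Subgroup G) :=
  {y | IsBorel y.2 ∧ y.1 ∈ y.2}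

/-- `ξ : (g, (B(W))) → (g, B(W₊))` (p. 257), «a well-defined morphism from `X` to the Springer–Grothendieck variety».
[cite: LanglandsShelstad1987, §5.2 (p. 257)] -/
def xiMap (Wplus : 𝒲) (x : G × Star G 𝒲) : G × Subgroup G := (x.1, x.2 Wplus)

/-- `π = π_𝔐 ∘ ξ : X → G`, the projection onto the first factor (p. 257). [cite: LanglandsShelstad1987, §5.2 (p. 257)] -/
def piMap (x : G × Star G 𝒲) : G := x.1

variable [TopologicalSpace (G × Star G 𝒲)]

omit [MulDistribMulAction Γ G] [MulAction Γ 𝒲] in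
/-- **[LanglandsShelstad1987, (5.2) (p. 257)]**: «Both `X⁰` and `X` are defined over `F`, and `X` is contained in
`{(g, s) : g ∈ s}`» — typed: the second clause, for `X = closure X⁰`. [cite: LanglandsShelstad1987, §5.2 (p. 257)] -/
def Par52ClosureInStars (IsRegSS : G → Prop) (s₀ : Star G 𝒲) : Prop :=
  XVar IsRegSS s₀ ⊆ {x | InStar x.1 x.2}

omit [MulDistribMulAction Γ G] [MulAction Γ 𝒲] [TopologicalSpace (G × Star G 𝒲)] in
/-- **[LanglandsShelstad1987, (5.2) (p. 257)]**: «Set `𝔐⁰ = π_𝔐⁻¹(G_{reg ss})`.  Then `ξ : X⁰ → 𝔐⁰` is an isomorphism» — typed on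
points: `ξ` is a bijection from `X⁰` onto `{(g, B) ∈ 𝔐 : g regular semisimple}`. [cite: LanglandsShelstad1987, §5.2 (p. 257)] -/
def Par52XiBijOnRegular (IsRegSS : G → Prop) (IsBorel : Subgroup G → Prop) (s₀ : Star G 𝒲) (Wplus : 𝒲) : Prop :=
  Set.BijOn (xiMap Wplus) (X0 IsRegSS s₀) {y | y ∈ springerGrothendieck G IsBorel ∧ IsRegSS y.1}

omit [MulDistribMulAction Γ G] [MulAction Γ 𝒲] in
/-- **[LanglandsShelstad1987, (5.2) (p. 257)]**: «If `γ ∈ T` is regular then `φ⁻¹(γ)` is the `G`-orbit of `(γ, s₀)` and so may be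
identified with the conjugacy class of `γ` in `G`.»  Data: `φ : G × Star → Tq` the map `φ = φ_𝔐 ∘ ξ` to `T = B_T/N_T` («`φ_𝔐(g, B) = γ`
if `h⁻¹gh ≡ γ mod N_T` where `B^h = B_T`»), `ι : Tq → G` the maximal torus `T ⊂ B_T` realising `T`, `IsRegT` its regular elements,
the `G`-orbit of `(γ, s₀)` being `{(g⁻¹γg, s₀^g)}`.  Typed: the fibre of `φ` in `X` over a regular `γ` equals that orbit.
[cite: LanglandsShelstad1987, §5.2 (p. 257)] -/
def Par52FibreRegular {Tq : Type*} (IsRegSS : G → Prop) (s₀ : Star G 𝒲) (φ : G × Star G 𝒲 → Tq) (ι : Tq → G)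
    (IsRegT : Tq → Prop) : Prop :=
  ∀ ⦃γ : Tq⦄, IsRegT γ →
    {x | x ∈ XVar IsRegSS s₀ ∧ φ x = γ} = Set.range fun g : G => (g⁻¹ * ι γ * g, starConj s₀ g)

/-- **[LanglandsShelstad1987, (5.2) (p. 257)]**: «If also `γ` is `F`-rational then `φ⁻¹(γ)(F)` is identified with the stable
conjugacy class of `γ` in `G(F)`» — the identification being `π : (g, s) ↦ g`, the `F`-points being the fixed points of
`(g, s) ↦ (σ(g), σ(s))`, and the stable conjugacy class of the (strongly) regular `γ` being the `F`-rational `G(F̄)`-conjugates of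
`γ` (p. 226).  Typed: for regular `Γ`-fixed `γ`, `π` is a bijection from `{x ∈ X : φ x = γ, x Γ-fixed}` onto
`{g ∈ G(F̄) : g Γ-fixed, IsConj (ι γ) g}`. [cite: LanglandsShelstad1987, §5.2 (p. 257)] -/
def Par52FibreRational {Tq : Type*} (IsRegSS : G → Prop) (s₀ : Star G 𝒲) (φ : G × Star G 𝒲 → Tq) (ι : Tq → G)
    (IsRegT : Tq → Prop) : Prop :=
  ∀ ⦃γ : Tq⦄, IsRegT γ → (∀ σ : Γ, σ • ι γ = ι γ) →
    Set.BijOn piMap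
      {x | x ∈ XVar IsRegSS s₀ ∧ φ x = γ ∧ ∀ σ : Γ, σ • x.1 = x.1 ∧ starGal σ x.2 = x.2}
      {g : G | (∀ σ : Γ, σ • g = g) ∧ IsConj (ι γ) g}

end FiveTwo

/-! ## (5.3) Regular unipotent elements and `X` (pp. 257–259) -/

section FiveThree

variable {G : Type*} [Group G] {Γ : Type*} [Group Γ] [MulDistribMulAction Γ G]
variable {Ω : Type*} [Group Ω] {𝒲 : Type*} [MulAction Ω 𝒲] [MulAction Γ 𝒲]

/-- `s_u` (p. 257): «Suppose `u ∈ G` is regular unipotent and contained in the Borel subgroup `B_u`.  Then we define the star `s_u`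
by `B(W) = B_u`, `W ∈ 𝒲`». [cite: LanglandsShelstad1987, §5.3 (p. 257)] -/
def starOfBorel (Bu : Subgroup G) : Star G 𝒲 := fun _ => Bu

/-- `x_u = (u, s_u)` (p. 257). [cite: LanglandsShelstad1987, §5.3 (p. 257)] -/
def pointOf (u : G) (Bu : Subgroup G) : G × Star G 𝒲 := (u, starOfBorel Bu)

omit [MulDistribMulAction Γ G] [MulAction Γ 𝒲] in
/-- **[LanglandsShelstad1987, Lemma 5.3.A (i) (p. 257)]**: «`x_u` lies in `X`» — for `u` regular unipotent (`IsRegUnip`) in the Borel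
subgroup `B_u` (`IsBorel`, the unique one), `X = closure X⁰` for the consumer's topology on `G × 𝔖`.
[cite: LanglandsShelstad1987, Lemma 5.3.A (i) (p. 257)] -/
def Lemma53Ai [TopologicalSpace (G × Star G 𝒲)] (IsRegSS IsRegUnip : G → Prop) (IsBorel : Subgroup G → Prop)
    (s₀ : Star G 𝒲) : Prop :=
  ∀ ⦃u : G⦄ ⦃Bu : Subgroup G⦄, IsRegUnip u → IsBorel Bu → u ∈ Bu → pointOf u Bu ∈ XVar IsRegSS s₀

/-- **[LanglandsShelstad1987, Lemma 5.3.A (ii) (p. 257)]**: «If `u ∈ G(F)` then `x_u ∈ X(F)`» — `G(F)` = the `Γ`-fixed elements of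
`G(F̄)`, `X(F)` = the points fixed by `(g, s) ↦ (σ(g), σ(s))` (the `F`-structure `starGal` of (5.2)).  Typed: for `u` regular
unipotent in the Borel subgroup `B_u` and `Γ`-fixed, `x_u` is `Γ`-fixed (with (i), `x_u ∈ X(F)`).
[cite: LanglandsShelstad1987, Lemma 5.3.A (ii) (p. 257)] -/
def Lemma53Aii (IsRegUnip : G → Prop) (IsBorel : Subgroup G → Prop) : Prop :=
  ∀ ⦃u : G⦄ ⦃Bu : Subgroup G⦄, IsRegUnip u → IsBorel Bu → u ∈ Bu → (∀ σ : Γ, σ • u = u) →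
    ∀ σ : Γ, starGal σ (starOfBorel (𝒲 := 𝒲) Bu) = starOfBorel Bu

/-- **[LanglandsShelstad1987, (5.3) (p. 258)]**, the `SL(2)` computation in the proof of Lemma 5.3.A: the condition that
`t exp(x_α(n)X_α) n′ ∈ B(ω(α)W₊)` «is the requirement in `SL(2)` that
`[[1,0],[z,1]] [[a,0],[0,a⁻¹]] [[1,x],[0,1]] [[1,0],[−z,1]] = [[a₁,x₁],[y₁,b₁]]` be upper triangular, where `x = x_α(n)`,
`z = z(W₊, α)` and `α(t) = a²`.  If `s` is regular then `z ≠ 0` and `xz = 1 − a⁻² = 1 − α(t)⁻¹`.  … Observe also that `a₁` is then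
`a⁻¹` and `x₁` is `a²x`» (the last read with `[[a₁,x₁],[0,b₁]] = t₁n₁`, `t₁ = ω(α)(t) = diag(a⁻¹, a)`, `x₁ = x_α(n₁)`).  Typed over
any field `K`, `a ≠ 0`: the `(2,1)` entry of the product vanishes iff `z = 0 ∨ xz = 1 − (a²)⁻¹`, and when `xz = 1 − (a²)⁻¹` the
product is `[[a⁻¹, a x],[0, a]] = diag(a⁻¹, a)·[[1, a²x],[0,1]]`. [cite: LanglandsShelstad1987, §5.3 (p. 258)] -/
def Par53SL2Computation (K : Type*) [Field K] : Prop :=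
  ∀ a x z : K, a ≠ 0 →
    ((!![1, 0; z, 1] * !![a, 0; 0, a⁻¹] * !![1, x; 0, 1] * !![1, 0; -z, 1] : Matrix (Fin 2) (Fin 2) K) 1 0 = 0 ↔
        z = 0 ∨ x * z = 1 - (a ^ 2)⁻¹) ∧
      (x * z = 1 - (a ^ 2)⁻¹ →
        (!![1, 0; z, 1] * !![a, 0; 0, a⁻¹] * !![1, x; 0, 1] * !![1, 0; -z, 1] : Matrix (Fin 2) (Fin 2) K) =
          !![a⁻¹, a * x; 0, a])

omit [MulAction Γ 𝒲] in
/-- **[LanglandsShelstad1987, Lemma 5.3.B (p. 258)]**: for `(h⁻¹ t n h, s) ∈ X` with `s ∈ 𝔖(B_∞, B)`, `t ∈ T`, `n ∈ N` (p. 257),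
`W = W(ω)` and `ωβ = α`: «If `n` is regular then `z(W, β) = (1 − β(t)⁻¹) / x(W, β)`, where `x(W, β)` is a rational function of `tn`
which is defined and equal to `x_α(n)` at `t = 1`.»  Data: `Tk` the torus `T(F̄)`, `Nk` the unipotent radical `N(F̄)`, `K = F̄`;
`rootVal β t = β(t)`; `z W β t n` the coordinate `z(W, β)` of the star through `tn`, `x W β t n` the function `x(W, β)` of `tn`;
`xroot α n = x_α(n)`; `R` the roots with the `Ω`-action; `IsRegN` the regular elements of `N`.  Typed (the identity in the
division-free form, and the value at `t = 1`): `z·x = 1 − β(t)⁻¹` and `x(W(ω), β)(1·n) = x_{ωβ}(n)`; the RATIONALITY of `x` in `tn`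
is not expressible on these carriers and is not recorded. [cite: LanglandsShelstad1987, Lemma 5.3.B (p. 258)] -/
def Lemma53BCoordinates {Tk Nk K R : Type*} [Group Tk] [Field K] [MulAction Ω R] (Wplus : 𝒲) (rootVal : R → Tk → K)
    (z x : 𝒲 → R → Tk → Nk → K) (xroot : R → Nk → K) (IsRegN : Nk → Prop) : Prop :=
  ∀ (ω : Ω) (β : R) (t : Tk) ⦃n : Nk⦄, IsRegN n →
    z (chamberOf Wplus ω) β t n * x (chamberOf Wplus ω) β t n = 1 - (rootVal β t)⁻¹ ∧
      x (chamberOf Wplus ω) β 1 n = xroot (ω • β) n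

end FiveThree

/-! ## (5.4) Orbital integrals as fibre integrals (pp. 259–261) -/

section FiveFour

variable {A B : Type*} [Group A] [Group B]
  [∀ b : B, MeasurableSpace (B ⧸ Subgroup.centralizer ({b} : Set B))]

/-- **[LanglandsShelstad1987, (5.4) (pp. 259–260)]**, the fibre-integral formula: «Then for `γ_H` strongly `G`-regular we may write
`D_H(γ_H) Σ_{γ_G} Δ(γ_H, γ_G) Φ(γ_G, f)` as `∫_{φ⁻¹(γ)(F)} Δ(x) f(π(x)) |ω_γ^*|`, where `Δ(x) = Δ(γ_H, π(x)) D_H(γ_H) D_G(γ)⁻¹`»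
(`γ` the image of `γ_H` under the fixed admissible `T_H → T`, `|ω_γ^*| = D_G(γ)|ω_G|/|ω_T|` the measure on the fibre, p. 259).
Data: `A = H(F)`, `B = G(F)`; `T` the transfer factor as ★ `TransferFactorData` (matching relation `R`); `m` the orbital measures of
(1.4) as an ★ `OrbitalMeasureFamily` on `G(F)`; `f : B → ℂ` (in print `f ∈ C_c^∞(G(F))`); at ONE strongly `G`-regular `γ_H = a`:
the fibre `φ⁻¹(γ)(F)` as a measure space `(Xγ, ωγ)` with `π : Xγ → G(F)`, and the numbers `DH = D_H(γ_H)`, `DG = D_G(γ)`.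
Typed: `DH · Σ_{[γ_G]} Δ(a, γ_G) Φ([γ_G], f) = ∫ Δ(a, π x) DH DG⁻¹ f(π x) dωγ(x)` (the class sum is the `finsum` of ★
`IsDeltaTransferRel`). [cite: LanglandsShelstad1987, §5.4 (p. 260)] -/
def Par54FibreIntegral {R : A → B → Prop} (T : TransferFactorData A B R) (m : OrbitalMeasureFamily B) (f : B → ℂ) (a : A)
    {Xγ : Type*} [MeasurableSpace Xγ] (ωγ : Measure Xγ) (π : Xγ → B) (DH DG : ℝ) : Prop :=
  (DH : ℂ) * ∑ᶠ c : ConjClasses B, T.Δ a (Quotient.out c) * classOrbitalIntegral m f c =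
    ∫ x, T.Δ a (π x) * (DH : ℂ) * ((DG : ℂ))⁻¹ * f (π x) ∂ωγ

variable {S : Type*} [Group S] {X : Type*} [AddCommGroup X] [DistribMulAction S X] {K : Type*} [Field K]
  {M : Type*} [AddCommGroup M] [SMul S M]

/-- **[LanglandsShelstad1987, Lemma 5.4.A (p. 260)]**: «`inv(γ_H, γ_G)⁻¹` is represented by the cocycle
`σ → λ(T)⁻¹ ∏^p_{1,σ} (−a_α / z(σ, α))^{α^∨}`», where (p. 259–260) `λ(T)` is the cocycle of (2.3) «computed relative to a-data
`{a_α}` and the splitting opposite to `(B, T, {X_α})`», `p` is «the gauge on the roots of `T` in `G` attached to `B_T`», `∏^p_{1,σ}`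
«a product over roots `α` such that `p(α) = 1` and `p(σ_T⁻¹α) = −1`», `z(σ, α) = z(−ω_{k−1}W₊, −α)` the star coordinate of
`x = (γ_G, s)` for `α = ω_{k−1}(α_k)` (reduced expression `ω_T(σ) = ω(α₁)⋯ω(α_r)`), and `inv(γ_H, γ_G) ∈ H¹(T)` is the class of
`σ → gσ(g)⁻¹` for `(γ_G, s) = (γ, s₀)^g` (p. 260; «we should pass to `G_sc`»).  Carriers (squad `Defs` conventions): `S = Γ`;
`X = X_*(T_sc)` with the `σ_T`-action; the roots indexed by their coroots `R ⊂ X` (as in (2.3)); gauge `p : X → ℤˣ`; a-data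
`a : X → Kˣ`, `K = F̄`; `z σ λ ∈ Kˣ` the coordinates (nonzero at regular stars, p. 258; junk outside `∏^p_{1,σ}`); `M` the
`Γ`-module `T_sc(F̄) = X ⊗ F̄^×` written additively with `cpow c λ = c^λ`; `lamT`, `invRep : Γ → M` representatives of `λ(T)` and of
`inv(γ_H, γ_G)`.  Typed: the printed cochain minus `(−invRep)` is a 1-coboundary (`groupCohomology.IsCoboundary₁`).
[cite: LanglandsShelstad1987, Lemma 5.4.A (p. 260)] -/
def Lemma54ACocycle (R : Finset X) (p : X → ℤˣ) (a : X → Kˣ) (z : S → X → Kˣ) (cpow : Kˣ → X → M)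
    (lamT invRep : S → M) : Prop :=
  groupCohomology.IsCoboundary₁ fun σ : S =>
    (-lamT σ + ∑ l ∈ R with (p l = 1 ∧ p (σ⁻¹ • l) = -1), cpow (-a l / z σ l) l) + invRep σ

/-- **[LanglandsShelstad1987, Lemma 5.4.B (p. 261)]**: «If `γ_G = n₁⁻¹ t n n₁` where `n ∈ N` is regular and `n₁ ∈ N_∞` then
`z(σ, α) = (1 − α(γ)) / x(σ, α)`, where `x(σ, α) → x_{α_k}(n)` as `γ → 1`» (`t = h⁻¹γh`, `α = ω_{k−1}(α_k)`; by Lemma 5.3.B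
applied to `z(−ω_{k−1}W₊, −α)`).  Data: `Tt = T(F)` a topological group, `sreg ⊆ T(F)` the (strongly) regular elements along which
`γ → 1`; for the fixed `n`, `n₁` and each pair `(σ, λ)` of `∏^p_{1,σ}` (gauge `p`, coroot index `λ = α^∨`): `z σ λ γ`, `x σ λ γ ∈ K`
the coordinate and the function of print as functions of `γ`, `rootVal λ γ = α(γ)`, `xlim σ λ = x_{α_k}(n)`; `K = F̄` with its
topology.  Typed: on `sreg`, `z·x = 1 − α(γ)` (division-free), and `Tendsto (x σ λ) (𝓝[sreg] 1) (𝓝 (xlim σ λ))`.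
[cite: LanglandsShelstad1987, Lemma 5.4.B (p. 261)] -/
def Lemma54BCoordinateLimit {Tt : Type*} [Group Tt] [TopologicalSpace Tt] [TopologicalSpace K] (sreg : Set Tt)
    (p : X → ℤˣ) (rootVal : X → Tt → K) (z x : S → X → Tt → K) (xlim : S → X → K) : Prop :=
  ∀ (σ : S) (l : X), p l = 1 → p (σ⁻¹ • l) = -1 →
    (∀ γ ∈ sreg, z σ l γ * x σ l γ = 1 - rootVal l γ) ∧ Tendsto (x σ l) (𝓝[sreg] 1) (𝓝 (xlim σ l))

end FiveFour

/-! ## (5.5) A limit formula (pp. 261–262) -/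

section FiveFive

variable {A B : Type*} [Group A] [Group B]
  [∀ a : A, MeasurableSpace (A ⧸ Subgroup.centralizer ({a} : Set A))]
  [∀ b : B, MeasurableSpace (B ⧸ Subgroup.centralizer ({b} : Set B))]

omit [∀ a : A, MeasurableSpace (A ⧸ Subgroup.centralizer ({a} : Set A))] in
/-- The right side of Theorem 5.5.A (p. 262): `λ_G(z₁) Σ_u Δ(u) Φ(zu, f)`, «where `Σ_u` indicates summation over representatives `u`
for the `G(F)`-conjugacy classes of regular unipotent elements in `G(F)`, and `Φ(zu, f) = ∫ f |ω_z|`, the integral being taken over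
the conjugacy class of `zu`, an open subset of `zU_reg(F)`».  Data: `lamGz = λ_G(z₁)`, `z ∈ G(F)` the image of `z₁` (central),
`𝓤` the (finitely many) regular unipotent classes of `G(F)`, `Δu` the factor `Δ(u)` of (5.1) (a class function,
`Par51FactorClassFunction`), `m` an ★ `OrbitalMeasureFamily` carrying `|ω_z|` on the classes `[zu]`; `Φ([zu], f)` = ★
`classOrbitalIntegral m f [z·u]` (a `finsum`; `0` if `𝓤` were infinite). [cite: LanglandsShelstad1987, Theorem 5.5.A (p. 262)] -/
noncomputable def unipotentSide (lamGz : ℂ) (z : B) (𝓤 : Set (ConjClasses B)) (Δu : B → ℂ) (m : OrbitalMeasureFamily B)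
    (f : B → ℂ) : ℂ :=
  lamGz * ∑ᶠ u ∈ 𝓤, Δu (Quotient.out u) * classOrbitalIntegral m f (ConjClasses.mk (z * Quotient.out u))

omit [∀ a : A, MeasurableSpace (A ⧸ Subgroup.centralizer ({a} : Set A))] in
/-- **[LanglandsShelstad1987, Theorem 5.5.A (p. 262)]** (setting of (5.5), p. 261–262: `H₁` a central extension of `H` as in (4.4),
`λ_G` the character on `Z₁^G(F)` = the preimage of `Z(F)` under `H₁(F) → H(F)`, `z₁ ↦ z` its projection onto `Z(F) ⊆ G(F)`, `γ₁`
ranging over elements of `H₁(F)` with strongly `G`-regular image):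
«`lim_{γ₁ → z₁} D_{H₁}(γ₁) Σ_{γ_G} Δ(γ₁, γ_G) Φ(γ_G, f)`, `f ∈ C_c^∞(G(F))`, is equal to `λ_G(z₁) Σ_u Δ(u) Φ(zu, f)`.»
Data: `A = H₁(F)` (topological group), `B = G(F)`; `T` the transfer factor `Δ(γ₁, γ_G)` as ★ `TransferFactorData` on the matching
relation `R`; `sreg` = «image strongly `G`-regular»; `DH1 = D_{H₁}`; `ZG1 = Z₁^G(F)`, `toZ` the projection `z₁ ↦ z`, `lamG = λ_G`;
`𝓤`, `Δu`, `m`, `f` as in `unipotentSide` (`m` also carries the measures `|ω_γ^*|`-side normalisation of (1.4) on the regular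
classes).  Typed: for `z₁ ∈ Z₁^G(F)`, `Tendsto (γ₁ ↦ D_{H₁}(γ₁) · Σᶠ_{[γ_G]} Δ(γ₁, γ_G) Φ([γ_G], f)) (𝓝[sreg] z₁) (𝓝 (unipotentSide …))`.
[cite: LanglandsShelstad1987, Theorem 5.5.A (p. 262)] -/
def Thm55ALimitFormula [TopologicalSpace A] {R : A → B → Prop} (T : TransferFactorData A B R) (sreg : Set A) (DH1 : A → ℝ)
    (ZG1 : Set A) (toZ : A → B) (lamG : A → ℂ) (𝓤 : Set (ConjClasses B)) (Δu : B → ℂ) (m : OrbitalMeasureFamily B)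
    (f : B → ℂ) : Prop :=
  ∀ ⦃z₁ : A⦄, z₁ ∈ ZG1 →
    Tendsto (fun γ₁ : A => (DH1 γ₁ : ℂ) * ∑ᶠ c : ConjClasses B, T.Δ γ₁ (Quotient.out c) * classOrbitalIntegral m f c)
      (𝓝[sreg] z₁) (𝓝 (unipotentSide (lamG z₁) (toZ z₁) 𝓤 Δu m f))

/-- **[LanglandsShelstad1987, Corollary 5.5.B (p. 262)]**: «If `f ∈ C_c^∞(G(F))` and `f¹ ∈ C_c^∞(H₁(F), λ)` have `Δ`-matching
orbital integrals then `Σ_{u₁} Φ(z₁u₁, f¹) = λ_G(z₁) Σ_u Δ(u) Φ(zu, f)`» (`u₁` over representatives of the regular unipotent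
classes of `H₁(F)`, `Φ(z₁u₁, f¹)` against `|ω_{z₁}|`).  Data: as in `Thm55ALimitFormula`, plus the `H₁`-side: `stA` stable conjugacy
and `regA` the `G`-regularity predicate of the matching relation ★ `IsDeltaTransferRel R stA regA T mH m f¹ f` («`Δ`-matching orbital
integrals»), `mH` the orbital measures on `H₁(F)` (carrying `|ω_{z₁}|`), `𝓤₁` the regular unipotent classes of `H₁(F)`.
Typed: matching ⇒ for every `z₁ ∈ Z₁^G(F)`, `Σᶠ_{u₁ ∈ 𝓤₁} Φ([z₁u₁], f¹) = unipotentSide (λ_G z₁) z 𝓤 Δu m f`.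
[cite: LanglandsShelstad1987, Corollary 5.5.B (p. 262)] -/
def Cor55BUnipotentMatching {R : A → B → Prop} (stA : A → A → Prop) (regA : A → Prop) (T : TransferFactorData A B R)
    (mH : OrbitalMeasureFamily A) (m : OrbitalMeasureFamily B) (ZG1 : Set A) (toZ : A → B) (lamG : A → ℂ)
    (𝓤₁ : Set (ConjClasses A)) (𝓤 : Set (ConjClasses B)) (Δu : B → ℂ) (f₁ : A → ℂ) (f : B → ℂ) : Prop :=
  IsDeltaTransferRel R stA regA T mH m f₁ f →
    ∀ ⦃z₁ : A⦄, z₁ ∈ ZG1 →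
      ∑ᶠ u₁ ∈ 𝓤₁, classOrbitalIntegral mH f₁ (ConjClasses.mk (z₁ * Quotient.out u₁)) =
        unipotentSide (lamG z₁) (toZ z₁) 𝓤 Δu m f

end FiveFive

section Discharges

/-- Discharge of `Par53SL2Computation`: the `SL(2)` identity of [LanglandsShelstad1987, (5.3) (p. 258)] holds over every
field — multiplying out, `[[1,0],[z,1]]·diag(a,a⁻¹)·[[1,x],[0,1]]·[[1,0],[−z,1]] = [[a − axz, ax],[z(a − axz − a⁻¹), zax + a⁻¹]]`,
whose `(2,1)` entry is `z·a·(1 − xz − a⁻²)` (closed form: quantified over the def՚s own parameters `K`, `[Field K]`; no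
hypotheses). [cite: LanglandsShelstad1987, §5.3 (p. 258)] -/
theorem Par53SL2Computation_holds : ∀ (K : Type*) [Field K], Par53SL2Computation K := by
  intro K _ a x z ha
  have hinv : a * (a ^ 2)⁻¹ = a⁻¹ := by
    rw [pow_two, mul_inv, ← mul_assoc, mul_inv_cancel₀ ha, one_mul]
  have hprod : (!![1, 0; z, 1] * !![a, 0; 0, a⁻¹] * !![1, x; 0, 1] * !![1, 0; -z, 1] : Matrix (Fin 2) (Fin 2) K) =
      !![a - a * x * z, a * x; z * (a - a * x * z - a⁻¹), z * a * x + a⁻¹] := by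
    ext i j
    fin_cases i <;> fin_cases j <;> simp [Matrix.mul_apply, Fin.sum_univ_two] <;> ring
  refine ⟨?_, fun hxz => ?_⟩
  · have h10 : (!![1, 0; z, 1] * !![a, 0; 0, a⁻¹] * !![1, x; 0, 1] * !![1, 0; -z, 1] : Matrix (Fin 2) (Fin 2) K) 1 0 =
        z * (a - a * x * z - a⁻¹) := by
      rw [hprod]; simp
    have key : a - a * x * z - a⁻¹ = a * (1 - x * z - (a ^ 2)⁻¹) := by
      rw [mul_sub, mul_sub, mul_one, hinv, mul_assoc]
    rw [h10, mul_eq_zero, key, mul_eq_zero_iff_left ha]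
    refine or_congr Iff.rfl ?_
    constructor <;> intro h <;> linear_combination -h
  · have h1 : a * x * z = a - a⁻¹ := by
      rw [mul_assoc, hxz, mul_sub, mul_one, hinv]
    have e10 : z * (a - a * x * z - a⁻¹) = 0 := by linear_combination (-z) * h1
    have e00 : a - a * x * z = a⁻¹ := by linear_combination -h1
    have e11 : z * a * x + a⁻¹ = a := by linear_combination h1
    rw [hprod, e10, e00, e11]

end Discharges

end Literature.NumberTheory.Automorphic.LanglandsShelstad1987.RegularUnipotent
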